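import Summits.QuantumFields.YangMills.Theorems.FluctuationComparisonRegPrIntLS2BetaRelativeKeyLemmaTorusGauged
import Summits.QuantumFields.YangMills.Theorems.FluctuationComparisonRegPrIntLS2BetaStageFlapLetterOfC4
import Summits.QuantumFields.YangMills.Theorems.FluctuationComparisonRegPrIntLS2BetaRelFlapOfFeedersAlgebra
import Summits.QuantumFields.YangMills.Theorems.FluctuationComparisonRegPrIntLS2BetaThresholdSum
import HarnessLib

/-!
# S2β · the (D-stage) REL-TEL road — ★★★ THE KEYREL DOOR: px12 g24's displayed prefix letter `KEYREL(G)` (the relative key-lemma tower in door currency,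
# the `hKEY` input of ✓p827346 `feedbackLetterPrefix_of_letters`) ⟸ THE BACKGROUND-TOWER LETTER ONLY — no window, no sup-closeness of the two stage towers

Cell `ym3-torus` (rung R3 = continuum `SU(2)` Yang–Mills on T³ — NOT d = 4, NOT infinite volume, NOT a mass gap, NOT Clay).  Width seat «width 10» `ym3-torus-px10`
(gen 24), FREE px helper on crux `stmt-QuantumFields-20520`; `--kind proof --supports … --as helper`, count-neutral, DEFINITION-FREE (0 `def`∕`instance`∕`notation`∕`sorry`).

WHAT.  ★★★ `keyRel_of_bkgTower (Gx) (hBkgT) : KEYREL(Gx)` — conclusion = HOME `ym3-torus-px12/g24/KEYREL.shape.px12g24.lean.txt` = ✓p827346's `hKEY` binder VERBATIM;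
`hBkgT` = ✓`bkgTower_of_bkgLetter`'s conclusion VERBATIM (as in ✓p827374 `flapLetter_of_C4`).  With it the (D)-side of GAP♯∘ under a guard `G′ ⟹ arc ≤ 1∕128` reads
`dStage_of_feedbackLetter G′ (feedbackLetterPrefix_of_letters G′ hG′ (keyRel_of_bkgTower G′ hBT) (flapLetter_of_C4 G′ hG′ hBT))`, `hBT := bkgTower_of_bkgLetter G′ hBkg`.
HOW (UV3-NODE §82.7 (3), px10 g24 LOCATE 15:41Z).  ✓∕⧗`relKeyLemma_torus_gauged` (the HISTORY-RADIUS, WINDOW-FREE (C)-side 7‴ ∘ 9‴ ∘ ✓p825006 in stage-gauge currency, towers rewritten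
by the (T3) clauses); `θ_t := θBal(K − t) + θ₀,t` (history ⟸ `histGood` + gauge invariance; BKG `θ₀,t := (C₁+1)·θ_J·L^{2t}·L^{−2(K−J)}`
⟸ `hBkgT`); guards and `X₁ := exp 1` by ✓`exists_gamma_forall_θBal_le` + ✓`thresholdSum_small` + ✓`geo_weight_sum_le_one`; LOOP ∕ TRANSPORT data := the supplier
right sides of ✓∕⧗`…RelativeKeyLemmaSuppliers` (px21 g23's relative Stokes read from the BKG side; walks); `qd_u ∝ θ₀,u` ⟹ the `δ`-clause by ✓`G_le_of_bkgPriced`; `qU := 0`.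
HONEST SCOPE.  Prefix plumbing + threshold bookkeeping over landed letters; `hBkgT` is a HYPOTHESIS (⟸ (BKG) ⟸ the Thm-1 pair: outright at `L ≥ 5`, EMBARGO-LITE №58 at
`L = 3`); nothing of Bałaban's renormalisation analysis is asserted; HLW∕(D-stage) need FLAPREL too (✓p827374); (F-stage), «CRIT-ax», GAP♯∘ (`stub_uniformFibreGapOrbit`),
S2β, the five registered stubs (0∕5), crux 20520 and `YM3TorusSU2` are NOT proved; no registered stub is closed; the Yang–Mills mass gap is NOT proved.
References: T. Bałaban, CMP **99** (1985) 75–102 [Balaban1985RegularSpaces] (Lemma 1 p.79, (1.29) p.81); CMP **98** (1985) 17–51 [Balaban1985Averaging] ((19)–(21)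
pp.21–22); CMP **102** (1985) 277–309 [Balaban1985Variational] (Thm 1 (9)–(10) p.279).
-/

set_option autoImplicit false

noncomputable section

namespace Summit.QuantumFields.YangMills.Theorems.FluctuationComparisonRegPrIntLS2BetaRelativeKeyLemmaDoor

open Finset
open scoped Real
open Literature.MathematicalPhysics.QuantumLattice (su2Quat)
open Literature.MathematicalPhysics.QuantumFieldTheory.Balaban1983to89
open T4Continuum T3ContinuumYM3Torus T3UnitScaleTilt T3TiltDescent T3LevelShift BlockAveraging AveragingRT
open T4CubeChartGnomonic (SU2)
open T4HaarSU2ExpChart (expPoint)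
open T4ExpWindowSmallField (logVec)
open T3UnitLawDensityEML (ℰp)
open T3ConstrainedMinimiser (fibre)
open T3PrintedRegularMinimiser (minActionRegPr)
open B10Eq27TorusAxialLog (rel axialT)
open T3Thresholds (exists_gamma_forall_θBal_le)
open T3MinimiserStabilityReduction (θBal_pos)
open T4TiltOscillation (bdev)
open ExpMeanLog (deltaSU deltaSU_pos expMeanLogSU)
open Summit.QuantumFields.YangMills.Theorems.FluctuationComparisonRegPrIntLS2BetaRelativeKeyLemmaTorusGauged (relKeyLemma_torus_gauged coef_nonneg)
open Summit.QuantumFields.YangMills.Theorems.FluctuationComparisonRegPrIntLS2BetaStageFlapLetterOfC4 (geo_weight_sum_le_one)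
open Summit.QuantumFields.YangMills.Theorems.FluctuationComparisonRegPrIntLS2BetaRelFlapOfFeedersAlgebra (G_le_of_bkgPriced)
open Summit.QuantumFields.YangMills.Theorems.FluctuationComparisonRegPrIntLS2BetaThresholdSum (thresholdSum_small)

/-! ## Two arithmetic helpers -/

/-- `A·x ≤ c` as soon as `x ≤ c∕(A + 1)` (`A, c ≥ 0`). [folklore] -/
theorem mul_le_of_le_div_add_one {A x c : ℝ} (hA : 0 ≤ A) (hc : 0 ≤ c) (hx : x ≤ c / (A + 1)) : A * x ≤ c := by
  have h1 : A * x ≤ A * (c / (A + 1)) := mul_le_mul_of_nonneg_left hx hA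
  have h2 : A * (c / (A + 1)) ≤ c := by
    rw [mul_div_assoc']
    rw [div_le_iff₀ (by linarith)]
    nlinarith
  exact h1.trans h2

/-- The unit torus's block map is three-dimensional with block size `F.L` (`rfl` lemmas, named for `rw`). [cite: Balaban1985UV3, (1)-(3) p.256] -/
theorem P_d_L (F : T3Family) (K : ℕ) : (F.P K).d = 3 ∧ (F.P K).L = F.L := ⟨rfl, rfl⟩

/-- The per-level budget coefficient is monotone in the history size `θH ≤ 1` (small atoms, for the door's `δ`-clause). [folklore] -/
theorem budget_core {G M R L3 θH θW : ℝ} (hG : 0 ≤ G) (hM : 0 ≤ M) (hR : 0 ≤ R) (hW : 0 ≤ θW) (hH1 : θH ≤ 1) :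
    (1400000 * (G * θH) * (G / 4 * (2 * θW * (M + 2))) + 700000 * (G * θW) * M + 5 * L3 * θW) * R ≤
      (1400000 * G * (G / 4 * (2 * (M + 2))) + 700000 * G * M + 5 * L3) * R * θW := by
  have hA : 0 ≤ 1400000 * G * (G / 4 * (2 * (M + 2))) := by positivity
  have h1 : 1400000 * G * (G / 4 * (2 * (M + 2))) * θH ≤ 1400000 * G * (G / 4 * (2 * (M + 2))) := mul_le_of_le_one_right hA hH1
  have e1 : (1400000 * (G * θH) * (G / 4 * (2 * θW * (M + 2))) + 700000 * (G * θW) * M + 5 * L3 * θW) * R =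
      (R * θW) * (1400000 * G * (G / 4 * (2 * (M + 2))) * θH + (700000 * G * M + 5 * L3)) := by ring
  have e2 : (1400000 * G * (G / 4 * (2 * (M + 2))) + 700000 * G * M + 5 * L3) * R * θW =
      (R * θW) * (1400000 * G * (G / 4 * (2 * (M + 2))) + (700000 * G * M + 5 * L3)) := by ring
  rw [e1, e2]
  exact mul_le_mul_of_nonneg_left (add_le_add h1 le_rfl) (mul_nonneg hR hW)

set_option maxHeartbeats 400000 in
/-- ★★★ **THE KEYREL DOOR**: px12 g24's `KEYREL(Gx)` from the background-tower letter alone — NO window, NO sup-closeness of the two stage towers (history-radius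
(C)-side ✓∕⧗`relKeyLemma_torus_hist`). [cite: Balaban1985RegularSpaces, Lemma 1 p.79, (1.29) p.81; Balaban1985Averaging, (19)-(21) pp.21-22; Balaban1985Variational, Thm 1 (9)-(10) p.279] -/
theorem keyRel_of_bkgTower
    (Gx : (F : T3Family) → (J : ℕ) → GaugeField (F.P J) 0 (Matrix.specialUnitaryGroup (Fin 2) ℂ) → Prop)
    (hBkgT : ∀ (L : ℕ), ∃ c₀ : ℝ, 0 < c₀ ∧ c₀ ≤ 1 ∧ ∀ (cw : ℝ), 0 < cw → cw ≤ c₀ → ∃ pS : ℝ, ∀ (b₀ p₀ : ℝ), 0 < b₀ → pS ≤ p₀ → 0 < p₀ → ∃ ε₁ : ℝ, 0 < ε₁ ∧ ∀ (ε₀ : ℝ), 0 < ε₀ → ε₀ ≤ ε₁ →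
    ∃ γ₁ : ℝ, 0 < γ₁ ∧ ∃ C₁ : ℝ, 0 ≤ C₁ ∧ ∀ (F : T3Family) (γ : ℝ), F.L = L → 0 < γ → γ ≤ γ₁ →
      ∀ (J K : ℕ) (hJK : J ≤ K) (V : GaugeField (F.P J) 0 (Matrix.specialUnitaryGroup (Fin 2) ℂ)), PlaqSmall (θBal F.L γ (cw * b₀) p₀ J) V →
        Gx F J V →
        ∀ U₀ ∈ {U' : GaugeField (F.P K) 0 (Matrix.specialUnitaryGroup (Fin 2) ℂ) | U' ∈ fibre F ℰp J K hJK V ∧ U' ∈ histGood F ℰp (θBal F.L γ b₀ p₀) K J ∧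
            wilsonAction4 U' = minActionRegPr F J K hJK ε₀ V},
        ∀ t, t ≤ K - J → ∀ p : Plaq (F.P K) t,
          dist1 (GaugeField.plaqHol (Averaging.iter (fun k => blockAvg (P := F.P K) (j := k) ℰp) t U₀) p) ≤
            C₁ * θBal F.L γ b₀ p₀ J * (F.L : ℝ) ^ (2 * t) * ((F.L : ℝ)⁻¹) ^ (2 * (K - J))) :
    ∀ (L : ℕ), ∃ c₀ : ℝ, 0 < c₀ ∧ c₀ ≤ 1 ∧ ∀ (cw : ℝ), 0 < cw → cw ≤ c₀ → ∃ pS : ℝ, ∀ (b₀ p₀ : ℝ), 0 < b₀ → pS ≤ p₀ → 0 < p₀ → ∃ ε₁ : ℝ, 0 < ε₁ ∧ ∀ (ε₀ : ℝ), 0 < ε₀ → ε₀ ≤ ε₁ →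
      ∃ X₁ : ℝ, 1 ≤ X₁ ∧ ∀ (δ : ℝ), 0 < δ → ∃ γ₁ : ℝ, 0 < γ₁ ∧ ∀ (F : T3Family) (γ : ℝ), F.L = L → 0 < γ → γ ≤ γ₁ →
        ∀ (J K : ℕ) (hJK : J ≤ K) (V : GaugeField (F.P J) 0 (Matrix.specialUnitaryGroup (Fin 2) ℂ)), PlaqSmall (θBal F.L γ (cw * b₀) p₀ J) V →
          Gx F J V →
          ∀ U₀ ∈ {U' : GaugeField (F.P K) 0 (Matrix.specialUnitaryGroup (Fin 2) ℂ) | U' ∈ fibre F ℰp J K hJK V ∧ U' ∈ histGood F ℰp (θBal F.L γ b₀ p₀) K J ∧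
              wilsonAction4 U' = minActionRegPr F J K hJK ε₀ V},
          ∀ U ∈ fibre F ℰp J K hJK V, U ∈ histGood F ℰp (θBal F.L γ b₀ p₀) K J →
          ∀ (wt : (j : ℕ) → PBond (F.P K) j → PBond (F.P K) (j + 1) → ℝ)
            (lift : (j : ℕ) → GaugeField (F.P K) (j + 1) SU2 → GaugeField (F.P K) j SU2),
            (∀ j b e, wt j b e = if e.dir = b.dir ∧ (b.src b.dir - emb e.src b.dir).val < (F.P K).L then
                ∏ ν ∈ Finset.univ.erase b.dir, max 0 (1 - ((rel (emb e.src) b.src ν).natAbs : ℝ) / (F.P K).L) else 0) →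
            (∀ j X b, lift j X b = expPoint (∑ e, wt j b e • ((((F.P K).L : ℕ) : ℝ)⁻¹ • logVec (su2Quat (X e))))) →
          ∀ g g₀ : (j : ℕ) → Site (F.P K) j → SU2,
            (∀ j, j < K - J → ∀ x, g j x =
              (axialT (lift j (GaugeField.gaugeAct (g (j + 1)) (Averaging.iter (fun k => blockAvg (P := F.P K) (j := k) ℰp) (j + 1) U)))
                  (emb (blockOf x)) x)⁻¹ *
                g (j + 1) (blockOf x) * axialT (Averaging.iter (fun k => blockAvg (P := F.P K) (j := k) ℰp) j U) (emb (blockOf x)) x) →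
            (∀ j, K - J ≤ j → ∀ y, g j y = 1) →
            (∀ j, j < K - J → ∀ y : Site (F.P K) (j + 1), g j (emb y) = g (j + 1) y) →
            (∀ X : GaugeField (F.P K) 0 SU2, ∀ j, j ≤ K - J →
              Averaging.iter (fun k => blockAvg (P := F.P K) (j := k) ℰp) j (GaugeField.gaugeAct (g 0) X) =
                GaugeField.gaugeAct (g j) (Averaging.iter (fun k => blockAvg (P := F.P K) (j := k) ℰp) j X)) →
            (∀ j, j < K - J → ∀ x,
              axialT (GaugeField.gaugeAct (g j) (Averaging.iter (fun k => blockAvg (P := F.P K) (j := k) ℰp) j U)) (emb (blockOf x)) x =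
                axialT (lift j (GaugeField.gaugeAct (g (j + 1)) (Averaging.iter (fun k => blockAvg (P := F.P K) (j := k) ℰp) (j + 1) U)))
                  (emb (blockOf x)) x) →
            (∀ j, j < K - J →
              (blockAvg (P := F.P K) (j := j) ℰp).avg (GaugeField.gaugeAct (g j) (Averaging.iter (fun k => blockAvg (P := F.P K) (j := k) ℰp) j U)) =
                GaugeField.gaugeAct (g (j + 1)) (Averaging.iter (fun k => blockAvg (P := F.P K) (j := k) ℰp) (j + 1) U)) →
            (∀ j, j < K - J → ∀ x, g₀ j x =
              (axialT (lift j (GaugeField.gaugeAct (g₀ (j + 1)) (Averaging.iter (fun k => blockAvg (P := F.P K) (j := k) ℰp) (j + 1) U₀)))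
                  (emb (blockOf x)) x)⁻¹ *
                g₀ (j + 1) (blockOf x) * axialT (Averaging.iter (fun k => blockAvg (P := F.P K) (j := k) ℰp) j U₀) (emb (blockOf x)) x) →
            (∀ j, K - J ≤ j → ∀ y, g₀ j y = 1) →
            (∀ j, j < K - J → ∀ y : Site (F.P K) (j + 1), g₀ j (emb y) = g₀ (j + 1) y) →
            (∀ X : GaugeField (F.P K) 0 SU2, ∀ j, j ≤ K - J →
              Averaging.iter (fun k => blockAvg (P := F.P K) (j := k) ℰp) j (GaugeField.gaugeAct (g₀ 0) X) =
                GaugeField.gaugeAct (g₀ j) (Averaging.iter (fun k => blockAvg (P := F.P K) (j := k) ℰp) j X)) →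
            (∀ j, j < K - J → ∀ x,
              axialT (GaugeField.gaugeAct (g₀ j) (Averaging.iter (fun k => blockAvg (P := F.P K) (j := k) ℰp) j U₀)) (emb (blockOf x)) x =
                axialT (lift j (GaugeField.gaugeAct (g₀ (j + 1)) (Averaging.iter (fun k => blockAvg (P := F.P K) (j := k) ℰp) (j + 1) U₀)))
                  (emb (blockOf x)) x) →
            (∀ j, j < K - J →
              (blockAvg (P := F.P K) (j := j) ℰp).avg (GaugeField.gaugeAct (g₀ j) (Averaging.iter (fun k => blockAvg (P := F.P K) (j := k) ℰp) j U₀)) =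
                GaugeField.gaugeAct (g₀ (j + 1)) (Averaging.iter (fun k => blockAvg (P := F.P K) (j := k) ℰp) (j + 1) U₀)) →
            ∃ (ηA qd qU : ℕ → ℝ), (∀ s, 0 ≤ qd s) ∧ (∀ s, 0 ≤ qU s) ∧
              (∀ t, t ≤ K - J →
                √(∑ q, dist1 ((GaugeField.plaqHol (GaugeField.gaugeAct (g₀ t) (Averaging.iter (fun k => blockAvg (P := F.P K) (j := k) ℰp) t U₀)) q)⁻¹ *
                  GaugeField.plaqHol (GaugeField.gaugeAct (g t) (Averaging.iter (fun k => blockAvg (P := F.P K) (j := k) ℰp) t U)) q) ^ 2) ≤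
                  X₁ * (Real.sqrt (F.L : ℝ) ^ t * √(∑ p, dist1 ((GaugeField.plaqHol (GaugeField.gaugeAct (g₀ 0) U₀) p)⁻¹ * GaugeField.plaqHol (GaugeField.gaugeAct (g 0) U) p) ^ 2) +
                    ∑ s ∈ range t, Real.sqrt (F.L : ℝ) ^ (t - 1 - s) * ηA s)) ∧
              (∀ s, s < K - J → ηA s ≤ qd s * √(∑ b, dist1 (GaugeField.gaugeAct (g s) (Averaging.iter (fun k => blockAvg (P := F.P K) (j := k) ℰp) s U) b *
                  (GaugeField.gaugeAct (g₀ s) (Averaging.iter (fun k => blockAvg (P := F.P K) (j := k) ℰp) s U₀) b)⁻¹) ^ 2) +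
                qU s * √(∑ b, dist1 (GaugeField.gaugeAct (g (s + 1)) (Averaging.iter (fun k => blockAvg (P := F.P K) (j := k) ℰp) (s + 1) U) b *
                  (GaugeField.gaugeAct (g₀ (s + 1)) (Averaging.iter (fun k => blockAvg (P := F.P K) (j := k) ℰp) (s + 1) U₀) b)⁻¹) ^ 2)) ∧
              ∑ j ∈ range (K - J), ∑ u ∈ range (j + 1), (F.L : ℝ) ^ (j - u) * qd u ≤ δ ∧
              ∑ j ∈ range (K - J), ∑ u ∈ range (j + 1), (F.L : ℝ) ^ (j - u) * qU u ≤ δ := by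
  intro L
  obtain ⟨c₀, hc₀, hc₀1, HB⟩ := hBkgT L
  refine ⟨c₀, hc₀, hc₀1, fun cw hcw hcwle => ?_⟩
  obtain ⟨pS, HB⟩ := HB cw hcw hcwle
  refine ⟨pS, fun b₀ p₀ hb hpS hp => ?_⟩
  obtain ⟨ε₁, hε₁, HB⟩ := HB b₀ p₀ hb hpS hp
  refine ⟨ε₁, hε₁, fun ε₀ hε₀ hε₀le => ?_⟩
  obtain ⟨γB, hγB, C₁₀, hC₁₀, HB⟩ := HB ε₀ hε₀ hε₀le
  obtain ⟨C₁, hC₁d⟩ : ∃ x : ℝ, x = C₁₀ + 1 := ⟨_, rfl⟩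
  have hC₁ : 0 ≤ C₁ := by rw [hC₁d]; positivity
  have hC₁p : 0 < C₁ := by rw [hC₁d]; positivity
  have hC₁lt : C₁₀ < C₁ := by rw [hC₁d]; linarith
  refine ⟨Real.exp 1, Real.one_le_exp (by norm_num), fun δ hδ => ?_⟩
  by_cases hL : 1 < L
  swap
  · exact ⟨1, one_pos, fun F γ hFL => absurd (hFL ▸ F.hL.2) hL⟩
  have hL' : (1 : ℝ) < L := by exact_mod_cast hL
  have hL0 : (0 : ℝ) < L := by linarith
  have hL2 : (2 : ℝ) ≤ L := by exact_mod_cast hL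
  -- the constants at `d = 3`, block `L`
  obtain ⟨G₀, hG₀⟩ : ∃ x : ℝ, x = (((3 + 2) * L : ℕ) : ℝ) ^ 2 := ⟨_, rfl⟩
  obtain ⟨M₅, hM₅⟩ : ∃ x : ℝ, x = (((3 + 2) * L : ℕ) : ℝ) := ⟨_, rfl⟩
  obtain ⟨Ra, hRa⟩ : ∃ x : ℝ, x = √(((3 ^ 3 * L ^ 3 * 3 ^ 2 : ℕ) : ℝ) * ((3 ^ 3 * 3 ^ 2 : ℕ) : ℝ)) := ⟨_, rfl⟩
  obtain ⟨Rb, hRb⟩ : ∃ x : ℝ, x = √(((3 ^ 3 * L ^ 3 * 3 : ℕ) : ℝ) * ((3 ^ 3 * 3 ^ 2 : ℕ) : ℝ)) := ⟨_, rfl⟩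
  have hG₀0 : 0 < G₀ := by rw [hG₀]; positivity
  have hM₅0 : 0 ≤ M₅ := by rw [hM₅]; positivity
  have hRa0 : 0 ≤ Ra := by rw [hRa]; positivity
  have hRb0 : 0 ≤ Rb := by rw [hRb]; positivity
  -- the exponent's coefficient per unit threshold and the budget's coefficient per unit background size
  obtain ⟨Cexp, hCexp⟩ : ∃ x : ℝ, x = 26 * G₀ + 1400000 * G₀ * (G₀ / 4) * Ra / Real.sqrt L := ⟨_, rfl⟩
  have hCexp0 : 0 ≤ Cexp := by rw [hCexp]; positivity
  obtain ⟨Cq, hCq⟩ : ∃ x : ℝ, x = (1400000 * G₀ * (G₀ / 4 * (2 * (M₅ + 2))) + 700000 * G₀ * M₅ + 5 * (L : ℝ) ^ 3) * Rb := ⟨_, rfl⟩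
  have hCq0 : 0 ≤ Cq := by rw [hCq]; positivity
  obtain ⟨Wq, hWq⟩ : ∃ x : ℝ, x = (L : ℝ) / (((L : ℝ) - 1) * ((L : ℝ) ^ 2 - 1)) := ⟨_, rfl⟩
  have hWq0 : 0 ≤ Wq := by
    rw [hWq]; have h1 : (0 : ℝ) < (L : ℝ) - 1 := by linarith
    have h2 : (0 : ℝ) < (L : ℝ) ^ 2 - 1 := by nlinarith
    positivity
  -- the threshold target
  have hδSU := deltaSU_pos (n := Fin 2)
  obtain ⟨σ, hσ⟩ : ∃ x : ℝ, x = min (min ((1 / 2) / (C₁ + 1)) ((1 / 800) / (G₀ * (1 + C₁) + 1)))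
      (min ((deltaSU (Fin 2) / 2) / (G₀ * (1 + C₁) + 1)) (min ((1 / 2) / (Cexp * C₁ + 1)) (δ / (Cq * C₁ * Wq + 1)))) := ⟨_, rfl⟩
  have hσ0 : 0 < σ := by
    rw [hσ]
    refine lt_min (lt_min (by positivity) (by positivity)) (lt_min (by positivity) (lt_min (by positivity) (by positivity)))
  have hσ1 : σ ≤ (1 / 2) / (C₁ + 1) := by rw [hσ]; exact (min_le_left _ _).trans (min_le_left _ _)
  have hσ2 : σ ≤ (1 / 800) / (G₀ * (1 + C₁) + 1) := by rw [hσ]; exact (min_le_left _ _).trans (min_le_right _ _)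
  have hσ3 : σ ≤ (deltaSU (Fin 2) / 2) / (G₀ * (1 + C₁) + 1) := by rw [hσ]; exact (min_le_right _ _).trans (min_le_left _ _)
  have hσ4 : σ ≤ (1 / 2) / (Cexp * C₁ + 1) := by rw [hσ]; exact (min_le_right _ _).trans ((min_le_right _ _).trans (min_le_left _ _))
  have hσ5 : σ ≤ δ / (Cq * C₁ * Wq + 1) := by rw [hσ]; exact (min_le_right _ _).trans ((min_le_right _ _).trans (min_le_right _ _))
  -- consequences for `Θ := (1 + C₁)·σ`
  have hΘ1 : (1 + C₁) * σ ≤ 1 / 2 := by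
    have h := (le_div_iff₀ (show (0 : ℝ) < C₁ + 1 by positivity)).mp hσ1
    linarith [h, show (1 + C₁) * σ = σ * (C₁ + 1) by ring]
  have hΘ2 : G₀ * ((1 + C₁) * σ) ≤ 1 / 800 := by
    rw [← mul_assoc]; exact mul_le_of_le_div_add_one (by positivity) (by norm_num) hσ2
  have hΘ3 : G₀ * ((1 + C₁) * σ) ≤ deltaSU (Fin 2) / 2 := by
    rw [← mul_assoc]; exact mul_le_of_le_div_add_one (by positivity) (by positivity) hσ3
  have hΘ4 : Cexp * C₁ * σ ≤ 1 / 2 := mul_le_of_le_div_add_one (by positivity) (by norm_num) hσ4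
  have hΘ5 : Cq * C₁ * Wq * σ ≤ δ := mul_le_of_le_div_add_one (by positivity) hδ.le hσ5
  -- the two `γ`'s of the thresholds
  obtain ⟨γt, hγt, hγt1, hth⟩ := exists_gamma_forall_θBal_le (b₀ := b₀) (p₀ := p₀) hb hp hσ0
  obtain ⟨γ₂, hγ₂, hth2⟩ := thresholdSum_small L hL b₀ p₀ hb hp Cexp 1 (1 / 2) hCexp0 one_pos (by norm_num)
  refine ⟨min γB (min γt γ₂), lt_min hγB (lt_min hγt hγ₂),
    fun F γ hFL hγ hγle J K hJK V hV hG U₀ hU₀ U hU hUg wt lift hw hlift g g₀ h0 h1 h2 h3 h4 h5 h0' h1' h2' h3' h4' h5' => ?_⟩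
  subst hFL
  have hγB' : γ ≤ γB := hγle.trans (min_le_left _ _)
  have hγt' : γ ≤ γt := hγle.trans ((min_le_right _ _).trans (min_le_left _ _))
  have hγ2' : γ ≤ γ₂ := hγle.trans ((min_le_right _ _).trans (min_le_right _ _))
  have hγ1 : γ ≤ 1 := hγt'.trans hγt1
  have hPd : (F.P K).d = 3 := rfl
  have hPL : (F.P K).L = F.L := rfl
  have hm : K - J ≤ (F.P K).m + (F.P K).K := by show K - J ≤ F.m + K; omega
  -- the block constants in the `F.P K` reading (small `rfl`-level conversions, used instead of rewriting `P.d`, `P.L` in large goals)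
  have hG0eq : ((((F.P K).d + 2) * (F.P K).L : ℕ) : ℝ) ^ 2 = G₀ := by rw [hG₀, hPd, hPL]
  have hM5eq : ((((F.P K).d + 2) * (F.P K).L : ℕ) : ℝ) = M₅ := by rw [hM₅, hPd, hPL]
  have hRaeq : √(((3 ^ (F.P K).d * (F.P K).L ^ (F.P K).d * (F.P K).d ^ 2 : ℕ) : ℝ) * ((3 ^ (F.P K).d * (F.P K).d ^ 2 : ℕ) : ℝ)) = Ra := by rw [hRa, hPd, hPL]
  have hRbeq : √(((3 ^ (F.P K).d * (F.P K).L ^ (F.P K).d * (F.P K).d : ℕ) : ℝ) * ((3 ^ (F.P K).d * (F.P K).d ^ 2 : ℕ) : ℝ)) = Rb := by rw [hRb, hPd, hPL]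
  have hLeq : ((F.P K).L : ℝ) = (F.L : ℝ) := by rw [hPL]
  have hlev : ∀ t, t < K - J → t + 1 ≤ (F.P K).m + (F.P K).K := fun t ht => by show t + 1 ≤ F.m + K; omega
  -- thresholds: history `θB`, background `θW`, their sum `θH`
  obtain ⟨θJ, hθJ⟩ : ∃ x : ℝ, x = θBal F.L γ b₀ p₀ J := ⟨_, rfl⟩
  obtain ⟨θB, hθB⟩ : ∃ f : ℕ → ℝ, f = fun t => θBal F.L γ b₀ p₀ (K - t) := ⟨_, rfl⟩
  obtain ⟨θW, hθW⟩ : ∃ f : ℕ → ℝ, f = fun t => C₁ * θJ * (F.L : ℝ) ^ (2 * t) * ((F.L : ℝ)⁻¹) ^ (2 * (K - J)) := ⟨_, rfl⟩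
  obtain ⟨θH, hθH⟩ : ∃ f : ℕ → ℝ, f = fun t => θB t + θW t := ⟨_, rfl⟩
  have hθBσ : ∀ t, θB t ≤ σ := fun t => by rw [hθB]; exact hth F.L F.hL.2.le γ hγ hγt' _
  have hθB0 : ∀ t, 0 ≤ θB t := fun t => by rw [hθB]; exact (θBal_pos F.hL.2.le hγ hγ1 hb p₀ _).le
  have hθJσ : θJ ≤ σ := by rw [hθJ]; exact hth F.L F.hL.2.le γ hγ hγt' J
  have hθJ0 : 0 < θJ := by rw [hθJ]; exact θBal_pos F.hL.2.le hγ hγ1 hb p₀ J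
  have hpow0 : ∀ t, 0 < (F.L : ℝ) ^ (2 * t) * ((F.L : ℝ)⁻¹) ^ (2 * (K - J)) := fun t => by positivity
  have hpowle : ∀ t, t ≤ K - J → (F.L : ℝ) ^ (2 * t) * ((F.L : ℝ)⁻¹) ^ (2 * (K - J)) ≤ 1 := by
    intro t ht
    rw [inv_pow, ← div_eq_mul_inv, div_le_one (by positivity)]
    exact pow_le_pow_right₀ hL'.le (by omega)
  have hθW0 : ∀ t, 0 < θW t := fun t => by
    simp only [hθW]; rw [mul_assoc (C₁ * θJ)]; exact mul_pos (mul_pos hC₁p hθJ0) (hpow0 t)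
  have hθWle : ∀ t, t ≤ K - J → θW t ≤ C₁ * σ := fun t ht => by
    simp only [hθW]
    calc C₁ * θJ * (F.L : ℝ) ^ (2 * t) * ((F.L : ℝ)⁻¹) ^ (2 * (K - J)) = C₁ * θJ * ((F.L : ℝ) ^ (2 * t) * ((F.L : ℝ)⁻¹) ^ (2 * (K - J))) := by ring
      _ ≤ C₁ * θJ * 1 := mul_le_mul_of_nonneg_left (hpowle t ht) (mul_nonneg hC₁ hθJ0.le)
      _ ≤ C₁ * σ := by rw [mul_one]; exact mul_le_mul_of_nonneg_left hθJσ hC₁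
  have hθHle : ∀ t, t ≤ K - J → θH t ≤ (1 + C₁) * σ := fun t ht => by
    simp only [hθH]; have := hθBσ t; have := hθWle t ht; linarith
  have hθH0 : ∀ t, 0 ≤ θH t := fun t => by simp only [hθH]; exact add_nonneg (hθB0 t) (hθW0 t).le
  have hθWH : ∀ t, θW t ≤ θH t := fun t => by simp only [hθH]; linarith [hθB0 t]
  have hθH1 : ∀ t, t ≤ K - J → θH t ≤ 1 := fun t ht => (hθHle t ht).trans (by linarith [hΘ1])
  -- the background tower's sizes, gauge-fixed: strict, with `C₁ = C₁₀ + 1`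
  have hBkg := HB F γ rfl hγ hγB' J K hJK V hV hG U₀ hU₀
  have hU₀s : ∀ t, t < K - J → PlaqSmall (θW t) (GaugeField.gaugeAct (g₀ t) (Averaging.iter (fun k => blockAvg (P := F.P K) (j := k) ℰp) t U₀)) := by
    intro t ht p
    rw [T4ReTrLipUnitary.plaqHol_gaugeAct, GaugeGroup.dist1_conj]
    refine (hBkg t ht.le p).trans_lt ?_
    simp only [hθW]
    have := mul_lt_mul_of_pos_right (mul_lt_mul_of_pos_right hC₁lt hθJ0) (hpow0 t)
    calc C₁₀ * θBal F.L γ b₀ p₀ J * (F.L : ℝ) ^ (2 * t) * ((F.L : ℝ)⁻¹) ^ (2 * (K - J))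
        = C₁₀ * θJ * ((F.L : ℝ) ^ (2 * t) * ((F.L : ℝ)⁻¹) ^ (2 * (K - J))) := by simp only [hθJ]; ring
      _ < C₁ * θJ * ((F.L : ℝ) ^ (2 * t) * ((F.L : ℝ)⁻¹) ^ (2 * (K - J))) := this
      _ = C₁ * θJ * (F.L : ℝ) ^ (2 * t) * ((F.L : ℝ)⁻¹) ^ (2 * (K - J)) := by ring
  -- the history tower's sizes, gauge-fixed
  have hUs : ∀ t, t < K - J → PlaqSmall (θH t) (GaugeField.gaugeAct (g t) (Averaging.iter (fun k => blockAvg (P := F.P K) (j := k) ℰp) t U)) := by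
    intro t ht p
    rw [T4ReTrLipUnitary.plaqHol_gaugeAct, GaugeGroup.dist1_conj]
    exact lt_of_lt_of_le (hUg t (by omega) p) (by simp only [hθH, hθB]; linarith [hθW0 t])
  -- the guards
  have hguard1 : ∀ t, t < K - J → ((((F.P K).d + 2) * (F.P K).L : ℕ) : ℝ) ^ 2 * θH t ≤ 1 / 800 := fun t ht => by
    rw [hG0eq]
    exact (mul_le_mul_of_nonneg_left (hθHle t ht.le) hG₀0.le).trans hΘ2
  have hguard2 : ∀ t, t < K - J → ((((F.P K).d + 2) * (F.P K).L : ℕ) : ℝ) ^ 2 / 4 * θH t < deltaSU (Fin 2) := fun t ht => by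
    rw [hG0eq]
    have h := (mul_le_mul_of_nonneg_left (hθHle t ht.le) hG₀0.le).trans hΘ3
    have hθ := hθH0 t
    nlinarith [hδSU, hG₀0]
  -- the exponent is at most `1`
  have hE : Real.exp (∑ i ∈ range (K - J), (26 * (((((F.P K).d + 2) * (F.P K).L : ℕ) : ℝ) ^ 2 * θH i) +
      ((1400000 * (((((F.P K).d + 2) * (F.P K).L : ℕ) : ℝ) ^ 2 * θH i)) * (((((F.P K).d + 2) * (F.P K).L : ℕ) : ℝ) ^ 2 / 4) + (700000 * (((((F.P K).d + 2) * (F.P K).L : ℕ) : ℝ) ^ 2 * θW i)) * 0) * √(((3 ^ (F.P K).d * (F.P K).L ^ (F.P K).d * (F.P K).d ^ 2 : ℕ) : ℝ) * ((3 ^ (F.P K).d * (F.P K).d ^ 2 : ℕ) : ℝ)) / Real.sqrt ((F.P K).L : ℝ))) ≤ Real.exp 1 := by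
    refine Real.exp_le_exp.mpr ?_
    rw [hG0eq, hRaeq, hLeq]
    have hterm : ∀ i, 26 * (G₀ * θH i) + ((1400000 * (G₀ * θH i)) * (G₀ / 4) + (700000 * (G₀ * θW i)) * 0) * Ra / Real.sqrt (F.L : ℝ) =
        Cexp * θB i + Cexp * θW i := fun i => by
      rw [hCexp]; simp only [hθH]; ring
    rw [Finset.sum_congr rfl (fun i _ => hterm i), Finset.sum_add_distrib, ← Finset.mul_sum, ← Finset.mul_sum]
    have hB := (hth2 γ hγ hγ2').2 J K hJK
    have hW : ∑ i ∈ range (K - J), θW i ≤ C₁ * σ := by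
      have hg := geo_weight_sum_le_one hL2 (K - J)
      calc ∑ i ∈ range (K - J), θW i = C₁ * θJ * ∑ i ∈ range (K - J), (F.L : ℝ) ^ (2 * i) * ((F.L : ℝ)⁻¹) ^ (2 * (K - J)) := by
            rw [Finset.mul_sum]; exact Finset.sum_congr rfl fun i _ => by simp only [hθW]; ring
        _ ≤ C₁ * θJ * 1 := mul_le_mul_of_nonneg_left hg (mul_nonneg hC₁ hθJ0.le)
        _ ≤ C₁ * σ := by rw [mul_one]; exact mul_le_mul_of_nonneg_left hθJσ hC₁
    have hW' : Cexp * ∑ i ∈ range (K - J), θW i ≤ 1 / 2 :=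
      (mul_le_mul_of_nonneg_left hW hCexp0).trans (by rw [← mul_assoc]; exact hΘ4)
    simp only [hθB] at hB ⊢
    linarith
  -- ### the window-free relative key lemma tower in stage-gauge currency (✓∕⧗`relKeyLemma_torus_gauged`), exponent priced by `exp 1`
  have HK := relKeyLemma_torus_gauged (P := F.P K) (n := Fin 2) hPd hm U U₀ g g₀ (h3 U) (h3' U₀) θH θW hθW0 hθWH hguard1 hguard2 hE hUs hU₀s
  -- ### the outputs: `qd`, `qU := 0`, `ηA := qd·B`
  refine ⟨fun s => ((1400000 * (((((F.P K).d + 2) * (F.P K).L : ℕ) : ℝ) ^ 2 * θH s)) * (((((F.P K).d + 2) * (F.P K).L : ℕ) : ℝ) ^ 2 / 4 * (2 * θW s * (((((F.P K).d + 2) * (F.P K).L : ℕ) : ℝ) + 2))) + (700000 * (((((F.P K).d + 2) * (F.P K).L : ℕ) : ℝ) ^ 2 * θW s)) * ((((F.P K).d + 2) * (F.P K).L : ℕ) : ℝ) +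
        5 * ((F.P K).L : ℝ) ^ 3 * θW s) * √(((3 ^ (F.P K).d * (F.P K).L ^ (F.P K).d * (F.P K).d : ℕ) : ℝ) * ((3 ^ (F.P K).d * (F.P K).d ^ 2 : ℕ) : ℝ)) *
      √(∑ b, dist1 (GaugeField.gaugeAct (g s) (Averaging.iter (fun k => blockAvg (P := F.P K) (j := k) ℰp) s U) b * (GaugeField.gaugeAct (g₀ s) (Averaging.iter (fun k => blockAvg (P := F.P K) (j := k) ℰp) s U₀) b)⁻¹) ^ 2),
    fun s => ((1400000 * (((((F.P K).d + 2) * (F.P K).L : ℕ) : ℝ) ^ 2 * θH s)) * (((((F.P K).d + 2) * (F.P K).L : ℕ) : ℝ) ^ 2 / 4 * (2 * θW s * (((((F.P K).d + 2) * (F.P K).L : ℕ) : ℝ) + 2))) + (700000 * (((((F.P K).d + 2) * (F.P K).L : ℕ) : ℝ) ^ 2 * θW s)) * ((((F.P K).d + 2) * (F.P K).L : ℕ) : ℝ) +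
        5 * ((F.P K).L : ℝ) ^ 3 * θW s) * √(((3 ^ (F.P K).d * (F.P K).L ^ (F.P K).d * (F.P K).d : ℕ) : ℝ) * ((3 ^ (F.P K).d * (F.P K).d ^ 2 : ℕ) : ℝ)),
    fun _ => 0, fun s => ?_, fun _ => le_rfl, fun t ht => ?_, fun s _ => ?_, ?_, ?_⟩
  · -- `0 ≤ qd s`
    exact coef_nonneg θH θW s (hθH0 s) (hθW0 s).le
  · -- the tower bound at level `t`
    exact HK t ht
  · -- `ηA s ≤ qd s·B_s + qU s·B_{s+1}`
    simp only [zero_mul, add_zero, le_refl]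
  · -- `Σ_j Σ_{u ≤ j} L^{j−u}·qd u ≤ δ`: BKG-priced (✓`G_le_of_bkgPriced`)
    have hx : ∀ u, u < K - J → ((1400000 * (((((F.P K).d + 2) * (F.P K).L : ℕ) : ℝ) ^ 2 * θH u)) * (((((F.P K).d + 2) * (F.P K).L : ℕ) : ℝ) ^ 2 / 4 * (2 * θW u * (((((F.P K).d + 2) * (F.P K).L : ℕ) : ℝ) + 2))) + (700000 * (((((F.P K).d + 2) * (F.P K).L : ℕ) : ℝ) ^ 2 * θW u)) * ((((F.P K).d + 2) * (F.P K).L : ℕ) : ℝ) +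
        5 * ((F.P K).L : ℝ) ^ 3 * θW u) * √(((3 ^ (F.P K).d * (F.P K).L ^ (F.P K).d * (F.P K).d : ℕ) : ℝ) * ((3 ^ (F.P K).d * (F.P K).d ^ 2 : ℕ) : ℝ)) ≤ (Cq * C₁ * θJ) * (F.L : ℝ) ^ (2 * u) * ((F.L : ℝ)⁻¹) ^ (2 * (K - J)) := by
      intro u hu
      have e : (Cq * C₁ * θJ) * (F.L : ℝ) ^ (2 * u) * ((F.L : ℝ)⁻¹) ^ (2 * (K - J)) = Cq * θW u := by simp only [hθW]; ring
      rw [e, hRbeq, hG0eq, hM5eq, hLeq, hCq]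
      exact budget_core hG₀0.le hM₅0 hRb0 (hθW0 u).le (hθH1 u hu.le)
    have hG := G_le_of_bkgPriced (L := (F.L : ℝ)) hL' (N := K - J) (κ := Cq * C₁ * θJ) (by positivity) _ hx
    refine hG.trans ?_
    have e3 : Cq * C₁ * θJ * (F.L : ℝ) / (((F.L : ℝ) - 1) * ((F.L : ℝ) ^ 2 - 1)) = Cq * C₁ * Wq * θJ := by rw [hWq]; ring
    rw [e3]
    calc Cq * C₁ * Wq * θJ ≤ Cq * C₁ * Wq * σ := mul_le_mul_of_nonneg_left hθJσ (by positivity)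
      _ ≤ δ := hΘ5
  · -- `Σ_j Σ_{u ≤ j} L^{j−u}·0 ≤ δ`
    simp only [mul_zero, Finset.sum_const_zero]
    exact hδ.le

end Summit.QuantumFields.YangMills.Theorems.FluctuationComparisonRegPrIntLS2BetaRelativeKeyLemmaDoor

end
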